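import Summits.QuantumFields.YangMills.Theorems.BalabanUVNodesN22WindowedTwoConstants
import Summits.QuantumFields.YangMills.Theorems.BalabanUVNodesN22KernelFadingOfStepRate

/-!
# BalabanUVNodes ∕ node N22 = NE9 — FADING MEMORY OF THE LIMITING KERNELS AT EVERY RATE ABOVE NODE N18's `θ`: ROAD 3 (two constants) AT THE KERNEL RECORD
# WITHOUT VITALI — node N18's kernel step rate + uniform kernel decay + (1.21) existence + WINDOWED coupling holomorphy on uniform margins ⟹ K3⁷ v5 §2b's `h9`
# with the record's geometric moduli under the row `ℓ.θ₅^{1−s} ≤ ℓ.ω`, i.e. for ANY fading rate `ℓ.ω ∈ ]ℓ.θ₅, 1[` (Track A, DAG node N22 = NE9; cluster K4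
# «SpineRates»; WIDTH SEAT `pub-ymgap-dag-n22-w1`, harness re-seat g4)

Cell `pub-ymgap`, HUMAN RULING D-0062 (Track A) ∕ D-0149; `--kind proof --supports stmt-QuantumFields-20544 --as helper` (K3⁷ `SpineGivenEndpointR13SepCoPH`, skeleton v5
941dddb108cb), COUNT-NEUTRAL.  THEOREMS ONLY (0 `def`, 0 `sorry`, standard axioms).  Imports this seat's `…N22WindowedTwoConstants` (`eventually_abs_sub_le_twoConstants`)
and dag-n22-c's J38 `…N22KernelFadingOfStepRate` (p622116: `osc_EA_of_kernelStepRate_decayBound`, `ne9_mono`, `update_mem_window`; through it dag-n22-w3's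
`ne9_EA_of_windowed` ∕ `n22At_rateCarriers_of_kernels_pin_of_ne9` ∕ `polLimitExists_zeroChart`, dag-n18-w4's `decayBound_EA_of_kernelStepRate_of_base`, node00-def-W1's
`Node00/U3OfKernels` ∕ `U3KernelLetters`, dag-n23-b's `polWindow_zeroChart` ∕ `polLimit_zeroChart`, dag-n22-a's `interp_geometric` ∕ `fadingMemory_geometric`) BY NAME.
The piece dag-n22-c g14 handed this seat (pub-ymgap INBOX l.35203 «OFFER-1 = YOURS — GO»).

WHY.  J38 carries dag-n22-a's ROAD 2 to the kernel record (N18's step rate ⟹ oscillation fading at `ℓ.θ₅`; + UNIFORM second differences ⟹ `h9` under `ℓ.θ₅ ≤ ℓ.ω²`, that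
road's TRUE exponent by `…N22KnitRoadRatesSharp`).  ROAD 3 (two constants, `…N22KnitTwoConstants`) gives EVERY rate above `ℓ.θ₅`, but its analytic hypothesis cannot sit
on the LIMITING kernels (no holomorphic extension of a (1.21) limit without Vitali ∕ Montel — dag-n22-c's located caveat).  THIS FILE runs ROAD 3 at each WINDOW: J38
§1's kernel oscillation letter (on the limits) + (1.21) convergence + WINDOWED coupling holomorphy on uniform margins (the finite-volume TYPE of [I] p. 263 «(or analytic)»,
DISPLAYED) give, by the companion's sequence theorem (equi-Lipschitz + finite net + two constants), an EVENTUAL windowed Lipschitz letter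
`c(s)·(θ^{1−s})^{age}·e^{−κ|z|₁}` in each young coupling; telescoped along hybrid histories (finitely many eventual statements) this is dag-n22-w3's windowed NE9
input, and `ne9_EA_of_windowed` passes it to the limits: `NE9 ∧ FadingMemory` of the kernel functional at the rate `θ^{1−s}` for EVERY `s ∈ ]0,1[`.  No second
differences, no holomorphy of the limits, no Vitali.

WHAT (all [folklore]; LOCATED — hypothesis form).
* §1 generic term family `ℰ`: `polWindow_congr_of_agree`, ★ `eventually_windowedCoordLetter_of_kernelFlat` (ONE young coupling),
  ★★ `eventually_windowedNE9Bound_of_kernelFlat` (telescoped: eventually `|Π^{(K)}(g) − Π^{(K)}(g')| ≤ e^{−κ|z|₁}Σ_m C₉τ_s^{k+1−m}|g_m − g'_m|`, `τ_s = θ^{1−s}`,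
  `C₉ = (32∕(s²·min(r∕2,γ∕2)))(2C₀)^{1−s}(2B)^{s}∕τ_s`), ★★★ `ne9_and_fadingMemory_EA_of_kernelStepRate_windowedHolo` (`KernelStepRate` (`C₅ ≥ 0`, `0 < θ < 1`) +
  `DecayBound (EA …) (Window γ) E₀ κ` (`E₀ > 0`) + `PolLimitExists` on the window + the windowed holomorphy datum (`B ≥ C₀ = 2C₅∕(1−θ) + 2E₀` — enlarge `B` if needed,
  `r > 0`) ⟹ for every `s ∈ ]0,1[`: `NE9 (EA F ℰ ρ bV) (Window γ) κ (C₉τ_s^{k−i}) ∧ FadingMemory C₉ τ_s _`), ★★ `…_base_windowedHolo` (level-0 (5.10) base, dag-n18-w4 BY NAME).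
* §2 at the record: ★★★ `ne9_EA_objectsOfRecord₁₃_of_kernelStepRate_windowedHolo` (= K3⁷ v5 §2b `h9` with `ℓ.moduli`: `KernelStepRateOfRecord₁₃` + uniform decay +
  `PolLimitsExistOfRecord₁₃` + the windowed holomorphy datum of the merged term family of record; rows `0 < s < 1`, `ℓ.θ₅^{1−s} ≤ ℓ.ω`, `ℓ.κ ≤ κ`, `C₉(s) ≤ ℓ.C₉`),
  ★★★ `n22At_rateCarriers_of_kernels_pin_of_kernelStepRate_windowedHolo` (the N22 pin face under v5's `hpin`).
* §3 RIDER (A5): `kernelA_zeroChart`, `ne9_and_fadingMemory_EA_zeroChart` — at the zero probe chart all four displayed inputs hold for EVERY `ℰ` and §1 fires (DEGENERATE).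
READING (letter block `Node00/RateRecord11.U3Letters₁₁`): the rows are jointly satisfiable with `ℓ.Signs` for EVERY `ℓ.ω ∈ ]ℓ.θ₅, 1[` (`s ≤ log ℓ.ω ∕ log ℓ.θ₅`, then `ℓ.C₉ ≥
C₉(s)`) — the analytic road books `ℓ.θ₅ < ℓ.ω`, J38's second-difference road `ℓ.θ₅ ≤ ℓ.ω²`; both are the true exponents of their roads (`…N22KnitRoadRatesSharp{,TwoConstants}`).
Which hypotheses Bałaban's kernels meet — the windowed holomorphy datum in particular (older couplings: node N10 «(or analytic)» transported to the terms ∕ NODE A;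
youngest: node N09's `EHoloAt`), now asked at FINITE VOLUME where it is natural — is the producers' business; its junction from J34-type OUTPUT-level margins through the
soft window machinery is the next located input (twin of dag-n22-c's J39).

HONEST FRAMING.  Count-neutral LOCATED junctions: node N18's kernel step rate, the uniform kernel decay, (1.21) existence and the windowed coupling-holomorphy datum are
DISPLAYED (hypotheses), asserted nowhere; nothing of Bałaban's is constructed; N22 NOT discharged (typed 28∕28 · discharged 5∕27 UNMOVED — the chair's single count line
is the only count); K3⁷ OPEN, NOT claimed, skeleton v5 untouched; NE5 ∕ NE9 NOT IN PRINT for d = 4; one finite four-torus programme at fixed ε — R4 closes the CONDITIONAL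
rung `BalabanLadder.UV` only; NOT infinite volume, NOT OS on ℝ⁴, NOT a mass gap, NOT Clay.

References (TYPES only): [I] = [Balaban1987RG1] T. Bałaban, Commun. Math. Phys. **109** (1987) 249–301 — Thm 1 p. 259, §1 p. 263 ((1.18), «C^∞ (or analytic)»), (1.20)–(1.22)
p. 264, (5.10) p. 293; [II] = [Balaban1988RG2Cluster] Commun. Math. Phys. **116** (1988) 1–22 — (2.13)–(2.14) pp. 14–15.
-/

noncomputable section

open Filter Topology Set Metric
open scoped BigOperators

namespace YMDAG.N22.KernelFadingTwoConstants

open Literature.MathematicalPhysics.QuantumFieldTheory.Balaban1983to89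
open Literature.MathematicalPhysics.QuantumFieldTheory.Balaban1983to89.T4Continuum (T4Family ULoop)
open Literature.MathematicalPhysics.QuantumFieldTheory.Balaban1983to89.T4OutputRate (Carriers Functional Window NE9 FadingMemory DecayBound PrefixDependenceOn)
open Literature.MathematicalPhysics.QuantumFieldTheory.Balaban1983to89.Node00 (TermFamily1 polWindow polLimit PolLimitExists tendsto_polLimit mergedTermFamilyMatT
  TβOfRecord₁₃ chiβOfRecord₁₃ Stage13Params Stage13HParams U3Letters₁₁ U3Objects₁₁)
open Literature.MathematicalPhysics.QuantumFieldTheory.Balaban1983to89.Node00.U3OfKernels (carriers pt histPrefix kernelA EA objectsOfRecord₁₃ kernelA_eq kernelA_congr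
  EA_apply)
open Literature.MathematicalPhysics.QuantumFieldTheory.Balaban1983to89.Node00.U3KernelLetters (KernelStepRate KernelStepRateOfRecord₁₃ PolLimitsExistOfRecord₁₃)
open Literature.MathematicalPhysics.QuantumFieldTheory.Balaban1983to89.B12Sec2to5 (l1 l1_nonneg)
open YMDAG.UVSplit (N22At RateReading₁₃CoPH rateCarriersOfRecord₁₃CoPH)
open YMDAG.N22.AtKernels (ne9_EA_of_windowed n22At_rateCarriers_of_kernels_pin_of_ne9 polLimitExists_zeroChart)
open Literature.MathematicalPhysics.QuantumFieldTheory.Balaban1983to89.Node00.Record8Inhabited (polWindow_zeroChart polLimit_zeroChart)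
open YMDAG.N22.KernelFading (ne9_mono osc_EA_of_kernelStepRate_decayBound update_mem_window)
open Literature.MathematicalPhysics.QuantumFieldTheory.Balaban1983to89.T4CouplingAnalyticity (hybrid hybrid_zero hybrid_succ update_hybrid_self hybrid_mem_window hybrid_apply_lt)
open YMDAG.N22.WindowedTwoConstants (eventually_abs_sub_le_twoConstants)
open Summit.QuantumFields.YangMills.BalabanUVNodes.N22KnitTwoConstants (interp_geometric)
open Summit.QuantumFields.YangMills.BalabanUVNodes.N22Knit (fadingMemory_geometric)
open YMDAG.N18.UniformDecayOfStepRate (decayBound_EA_of_kernelStepRate_of_base)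

open scoped Matrix.Norms.L2Operator

/-! ## §1 Generic term family `ℰ`: ONE young coupling, then the telescoped windowed letter, then NE9 ∧ fading memory of the limiting kernels -/

section Generic

variable {𝔄 : Type*} [NormedRing 𝔄] [NormedAlgebra ℝ 𝔄]
variable {V : Type*} [NormedAddCommGroup V] [NormedSpace ℝ V] {ι : Type*} [Fintype ι]
variable (F : T4Family) (ℰ : TermFamily1 F 𝔄) (ρ : V →L[ℝ] 𝔄) (bV : Module.Basis ι ℝ V)

/-- The history prefix of a one-coupling update depends on the updated value only through that coordinate: two histories agreeing below the
scale have the same windowed kernels. [folklore] -/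
theorem polWindow_congr_of_agree {g g' : ℕ → ℝ} {k : ℕ} (h : ∀ i < k + 1, g i = g' i) (K : ℕ) (μ ν : Fin 4) (z : Fin 4 → ℤ) :
    polWindow F K (k + 1) (ℰ k (histPrefix g k) K) ρ bV μ ν z = polWindow F K (k + 1) (ℰ k (histPrefix g' k) K) ρ bV μ ν z := by
  have e : histPrefix g k = histPrefix g' k := funext fun i => h i.1 i.2
  rw [e]

/-- ★ **ONE YOUNG COUPLING — THE EVENTUAL WINDOWED LETTER** (the companion's sequence theorem in kernel currency): the LIMITING section `t ↦ Π_{k+1}(h|h_i:=t; z)`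
is `ε·e^{−κ|z|₁}`-flat on `]0, γ]` (`0 < ε ≤ B`), the (1.21) limits exist along the updates, and EVENTUALLY IN `K` the windowed section extends holomorphically with
bound `B·e^{−κ|z|₁}` on the closed `r`-discs about `]0, γ]` ⟹ eventually `|Π^{(K)}(h|h_i:=x) − Π^{(K)}(h|h_i:=y)| ≤ (32∕(s²r₁))(2εe^{−κ|z|₁})^{1−s}(2Be^{−κ|z|₁})^{s}|x − y|`. [folklore] -/
theorem eventually_windowedCoordLetter_of_kernelFlat {γ κ r B ε s : ℝ} (hγ : 0 < γ) (hr : 0 < r) (hε : 0 < ε) (hεB : ε ≤ B)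
    (hs0 : 0 < s) (hs1 : s < 1) (h : ℕ → ℝ) (i k : ℕ) (μ ν : Fin 4) (z : Fin 4 → ℤ)
    (hflat : ∀ x ∈ Ioc (0 : ℝ) γ, ∀ y ∈ Ioc (0 : ℝ) γ,
      |kernelA F ℰ ρ bV (Function.update h i x) k μ ν z - kernelA F ℰ ρ bV (Function.update h i y) k μ ν z| ≤ ε * Real.exp (-(κ * l1 z)))
    (hlim : ∀ t ∈ Ioc (0 : ℝ) γ, PolLimitExists F (k + 1) (fun K => ℰ k (histPrefix (Function.update h i t) k) K) ρ bV)
    (hA : ∀ᶠ K in atTop, ∃ (Fc : ℂ → ℂ) (D : Set ℂ), DifferentiableOn ℂ Fc D ∧ (∀ w ∈ D, ‖Fc w‖ ≤ B * Real.exp (-(κ * l1 z))) ∧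
      (∀ t ∈ Ioc (0 : ℝ) γ, closedBall (t : ℂ) r ⊆ D) ∧
      (∀ t ∈ Ioc (0 : ℝ) γ, Fc t = (polWindow F K (k + 1) (ℰ k (histPrefix (Function.update h i t) k) K) ρ bV μ ν z : ℂ))) :
    ∀ᶠ K in atTop, ∀ x ∈ Ioc (0 : ℝ) γ, ∀ y ∈ Ioc (0 : ℝ) γ,
      |polWindow F K (k + 1) (ℰ k (histPrefix (Function.update h i x) k) K) ρ bV μ ν z -
          polWindow F K (k + 1) (ℰ k (histPrefix (Function.update h i y) k) K) ρ bV μ ν z| ≤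
        32 / (s ^ 2 * min (r / 2) (γ / 2)) * (2 * (ε * Real.exp (-(κ * l1 z)))) ^ (1 - s) *
          (2 * (B * Real.exp (-(κ * l1 z)))) ^ s * |x - y| := by
  have hw : 0 < Real.exp (-(κ * l1 z)) := Real.exp_pos _
  refine eventually_abs_sub_le_twoConstants
    (Fk := fun K t => polWindow F K (k + 1) (ℰ k (histPrefix (Function.update h i t) k) K) ρ bV μ ν z)
    (f := fun t => kernelA F ℰ ρ bV (Function.update h i t) k μ ν z) hγ hr (mul_pos hε hw)
    (mul_le_mul_of_nonneg_right hεB hw.le) hs0 hs1 hA (fun t ht => ?_) hflat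
  rw [kernelA_eq]
  exact tendsto_polLimit F (k + 1) _ ρ bV (hlim t ht) μ ν z

/-- ★★ **THE TELESCOPED WINDOWED LETTER, EVENTUALLY IN THE VOLUME**: kernel-level `C₀θ^{k−m}e^{−κ|z|₁}`-flatness in every young coupling `m ≤ k` at every window base
history (`0 < C₀ ≤ B`) + (1.21) existence + the windowed holomorphy datum ⟹ eventually `|Π^{(K)}_{k+1}(g; z) − Π^{(K)}_{k+1}(g'; z)| ≤ e^{−κ|z|₁}Σ_{m<k+1} C₉τ_s^{k+1−m}|g_m − g'_m|`,
`τ_s = θ^{1−s}`, `C₉ = (32∕(s²r₁))(2C₀)^{1−s}(2B)^{s}∕τ_s` — the one-coupling letters along pv10's hybrid histories (`T4CouplingAnalyticity.hybrid` BY NAME), finitely many eventual statements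
summed. [folklore] -/
theorem eventually_windowedNE9Bound_of_kernelFlat {γ κ θ r B C₀ s : ℝ} (hγ : 0 < γ) (hr : 0 < r) (hθ0 : 0 < θ) (hθ1 : θ ≤ 1)
    (hC₀ : 0 < C₀) (hCB : C₀ ≤ B) (hs0 : 0 < s) (hs1 : s < 1)
    (hflat : ∀ h ∈ Window γ, ∀ (k : ℕ) (μ ν : Fin 4) (z : Fin 4 → ℤ) (m : ℕ), m < k + 1 → ∀ x ∈ Ioc (0 : ℝ) γ, ∀ y ∈ Ioc (0 : ℝ) γ,
      |kernelA F ℰ ρ bV (Function.update h m x) k μ ν z - kernelA F ℰ ρ bV (Function.update h m y) k μ ν z| ≤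
        C₀ * θ ^ (k - m) * Real.exp (-(κ * l1 z)))
    (hlim : ∀ g ∈ Window γ, ∀ k : ℕ, PolLimitExists F (k + 1) (fun K => ℰ k (histPrefix g k) K) ρ bV)
    (hA : ∀ h ∈ Window γ, ∀ (k : ℕ) (μ ν : Fin 4) (z : Fin 4 → ℤ) (m : ℕ), m < k + 1 → ∀ᶠ K in atTop,
      ∃ (Fc : ℂ → ℂ) (D : Set ℂ), DifferentiableOn ℂ Fc D ∧ (∀ w ∈ D, ‖Fc w‖ ≤ B * Real.exp (-(κ * l1 z))) ∧
        (∀ t ∈ Ioc (0 : ℝ) γ, closedBall (t : ℂ) r ⊆ D) ∧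
        (∀ t ∈ Ioc (0 : ℝ) γ, Fc t = (polWindow F K (k + 1) (ℰ k (histPrefix (Function.update h m t) k) K) ρ bV μ ν z : ℂ)))
    {g g' : ℕ → ℝ} (hg : g ∈ Window γ) (hg' : g' ∈ Window γ) (k : ℕ) (μ ν : Fin 4) (z : Fin 4 → ℤ) :
    ∀ᶠ K in atTop,
      |polWindow F K (k + 1) (ℰ k (histPrefix g k) K) ρ bV μ ν z - polWindow F K (k + 1) (ℰ k (histPrefix g' k) K) ρ bV μ ν z| ≤
        Real.exp (-(κ * l1 z)) * ∑ m ∈ Finset.range (k + 1),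
          32 / (s ^ 2 * min (r / 2) (γ / 2)) * ((2 * C₀) ^ (1 - s) * (2 * B) ^ s) / θ ^ (1 - s) *
            (θ ^ (1 - s)) ^ (k + 1 - m) * |g m - g' m| := by
  set w : ℝ := Real.exp (-(κ * l1 z)) with hw
  have hw0 : 0 < w := Real.exp_pos _
  set τ : ℝ := θ ^ (1 - s) with hτ
  have hτ0 : 0 < τ := Real.rpow_pos_of_pos hθ0 _
  set c : ℝ := 32 / (s ^ 2 * min (r / 2) (γ / 2)) * ((2 * C₀) ^ (1 - s) * (2 * B) ^ s) with hc
  set W : ℕ → (ℕ → ℝ) → ℝ := fun K h => polWindow F K (k + 1) (ℰ k (histPrefix h k) K) ρ bV μ ν z with hW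
  set hyb : ℕ → ℕ → ℝ := fun m => hybrid g g' m with hhyb
  have hhybW : ∀ m, hyb m ∈ Window γ := fun m => hybrid_mem_window hg hg' m
  -- the one-coupling step along the hybrids, with the interpolated constant
  have hstep : ∀ m, m < k + 1 → ∀ᶠ K in atTop, |W K (hyb m) - W K (hyb (m + 1))| ≤ w * (c * τ ^ (k - m)) * |g m - g' m| := by
    intro m hm
    have hB : 0 < B := hC₀.trans_le hCB
    have hεB : C₀ * θ ^ (k - m) ≤ B := (mul_le_of_le_one_right hC₀.le (pow_le_one₀ hθ0.le hθ1)).trans hCB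
    have h1 := eventually_windowedCoordLetter_of_kernelFlat F ℰ ρ bV hγ hr (by positivity) hεB hs0 hs1 (hyb m) m k μ ν z
      (hflat (hyb m) (hhybW m) k μ ν z m hm) (fun t ht => hlim _ (update_mem_window (hhybW m) m ht) k)
      (hA (hyb m) (hhybW m) k μ ν z m hm)
    filter_upwards [h1] with K hK
    have h2 := hK (g m) ⟨(hg m).1, (hg m).2⟩ (g' m) ⟨(hg' m).1, (hg' m).2⟩
    have e1 : Function.update (hyb m) m (g m) = hyb m := update_hybrid_self g g' m
    have e2 : Function.update (hyb m) m (g' m) = hyb (m + 1) := (hybrid_succ g g' m).symm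
    rw [e1, e2] at h2
    have e3 : 32 / (s ^ 2 * min (r / 2) (γ / 2)) * (2 * (C₀ * θ ^ (k - m) * w)) ^ (1 - s) * (2 * (B * w)) ^ s
        = w * (c * τ ^ (k - m)) := by
      rw [show 2 * (C₀ * θ ^ (k - m) * w) = 2 * C₀ * θ ^ (k - m) * w by ring,
        show 2 * (B * w) = 2 * B * (1 : ℝ) ^ (k - m) * w by rw [one_pow]; ring, mul_assoc,
        interp_geometric (by positivity : (0 : ℝ) < 2 * C₀) hB hθ0 one_pos hw0 (k - m), Real.one_rpow, mul_one, hc, hτ]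
      ring
    rw [e3] at h2
    exact h2
  -- telescoping: eventually, `|W g − W (hyb m)| ≤ w Σ_{j<m} c τ^{k−j} |g j − g' j|`
  have htel : ∀ m, m ≤ k + 1 → ∀ᶠ K in atTop, |W K g - W K (hyb m)| ≤ w * ∑ j ∈ Finset.range m, c * τ ^ (k - j) * |g j - g' j| := by
    intro m
    induction m with
    | zero =>
      intro _
      refine Eventually.of_forall fun K => ?_
      have e : hyb 0 = g := hybrid_zero g g'
      rw [e, sub_self, abs_zero, Finset.sum_range_zero, mul_zero]
    | succ m ih =>
      intro hm
      filter_upwards [ih (by omega), hstep m (by omega)] with K h1 h2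
      rw [Finset.sum_range_succ, mul_add]
      calc |W K g - W K (hyb (m + 1))| = |(W K g - W K (hyb m)) + (W K (hyb m) - W K (hyb (m + 1)))| := by ring_nf
        _ ≤ |W K g - W K (hyb m)| + |W K (hyb m) - W K (hyb (m + 1))| := abs_add_le _ _
        _ ≤ w * ∑ j ∈ Finset.range m, c * τ ^ (k - j) * |g j - g' j| + w * (c * τ ^ (k - m)) * |g m - g' m| := add_le_add h1 h2
        _ = w * ∑ j ∈ Finset.range m, c * τ ^ (k - j) * |g j - g' j| + w * (c * τ ^ (k - m) * |g m - g' m|) := by ring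
  have hlast : ∀ K, W K (hyb (k + 1)) = W K g' := fun K =>
    polWindow_congr_of_agree F ℰ ρ bV (fun i hi => hybrid_apply_lt g g' hi) K μ ν z
  filter_upwards [htel (k + 1) le_rfl] with K hK
  rw [hlast K] at hK
  refine hK.trans (le_of_eq ?_)
  congr 1
  refine Finset.sum_congr rfl fun m hm => ?_
  have hmk : m ≤ k := Nat.lt_succ_iff.mp (Finset.mem_range.mp hm)
  rw [show k + 1 - m = (k - m) + 1 by omega, pow_succ]
  field_simp

/-- ★★★ **NE9 ∧ FADING MEMORY OF THE KERNEL FUNCTIONAL AT EVERY RATE ABOVE NODE N18's `θ`.**  For a term family `ℰ` on `]0, γ]^ℕ` (`γ > 0`): (N18)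
`KernelStepRate F ℰ ρ bV γ κ θ C₅` (`C₅ ≥ 0`, `0 < θ < 1`); (1.18) `DecayBound (EA …) (Window γ) E₀ κ` (`E₀ > 0`); (1.21) `PolLimitExists` on the window; (hol) EVENTUALLY IN
`K`, the windowed section in each young coupling extends holomorphically with bound `B·e^{−κ|z|₁}` on the closed `r`-discs about `]0, γ]` (`B ≥ C₀ := 2C₅∕(1−θ) + 2E₀`,
`r > 0`; the finite-volume TYPE of [I] p. 263 «(or analytic)», DISPLAYED) ⟹ for EVERY `s ∈ ]0, 1[`: **`NE9 (EA F ℰ ρ bV) (Window γ) κ Λ ∧ FadingMemory C₉ θ^{1−s} Λ`**,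
`Λ k i = C₉(θ^{1−s})^{k−i}`, `C₉ = (32∕(s²·min(r∕2,γ∕2)))(2C₀)^{1−s}(2B)^{s}∕θ^{1−s}` — J38 §1's oscillation letter + the companion's sequence theorem + `ne9_EA_of_windowed`. [folklore] -/
theorem ne9_and_fadingMemory_EA_of_kernelStepRate_windowedHolo {γ κ θ C₅ E₀ B r s : ℝ}
    (hC₅ : 0 ≤ C₅) (hθ0 : 0 < θ) (hθ1 : θ < 1) (hE₀ : 0 < E₀) (hγ : 0 < γ) (hr : 0 < r) (hs0 : 0 < s) (hs1 : s < 1)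
    (h5 : KernelStepRate F ℰ ρ bV γ κ θ C₅) (hdec : DecayBound (EA F ℰ ρ bV) (Window γ) E₀ κ)
    (hCB : 2 * C₅ / (1 - θ) + 2 * E₀ ≤ B)
    (hlim : ∀ g ∈ Window γ, ∀ k : ℕ, PolLimitExists F (k + 1) (fun K => ℰ k (histPrefix g k) K) ρ bV)
    (hA : ∀ h ∈ Window γ, ∀ (k : ℕ) (μ ν : Fin 4) (z : Fin 4 → ℤ) (m : ℕ), m < k + 1 → ∀ᶠ K in atTop,
      ∃ (Fc : ℂ → ℂ) (D : Set ℂ), DifferentiableOn ℂ Fc D ∧ (∀ w ∈ D, ‖Fc w‖ ≤ B * Real.exp (-(κ * l1 z))) ∧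
        (∀ t ∈ Ioc (0 : ℝ) γ, closedBall (t : ℂ) r ⊆ D) ∧
        (∀ t ∈ Ioc (0 : ℝ) γ, Fc t = (polWindow F K (k + 1) (ℰ k (histPrefix (Function.update h m t) k) K) ρ bV μ ν z : ℂ))) :
    NE9 (EA F ℰ ρ bV) (Window γ) κ
        (fun k i => 32 / (s ^ 2 * min (r / 2) (γ / 2)) * ((2 * (2 * C₅ / (1 - θ) + 2 * E₀)) ^ (1 - s) * (2 * B) ^ s) / θ ^ (1 - s) *
          (θ ^ (1 - s)) ^ (k - i)) ∧
      FadingMemory (32 / (s ^ 2 * min (r / 2) (γ / 2)) * ((2 * (2 * C₅ / (1 - θ) + 2 * E₀)) ^ (1 - s) * (2 * B) ^ s) / θ ^ (1 - s))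
        (θ ^ (1 - s))
        (fun k i => 32 / (s ^ 2 * min (r / 2) (γ / 2)) * ((2 * (2 * C₅ / (1 - θ) + 2 * E₀)) ^ (1 - s) * (2 * B) ^ s) / θ ^ (1 - s) *
          (θ ^ (1 - s)) ^ (k - i)) := by
  have h1θ : 0 < 1 - θ := by linarith
  have hC₀ : 0 < 2 * C₅ / (1 - θ) + 2 * E₀ := by positivity
  have hτ0 : 0 < θ ^ (1 - s) := Real.rpow_pos_of_pos hθ0 _
  -- the kernel oscillation letter between one-coupling updates (J38 §1)
  have hosc := osc_EA_of_kernelStepRate_decayBound F ℰ ρ bV hC₅ hθ0.le hθ1 hE₀.le h5 hdec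
  have hflat : ∀ h ∈ Window γ, ∀ (k : ℕ) (μ ν : Fin 4) (z : Fin 4 → ℤ) (m : ℕ), m < k + 1 → ∀ x ∈ Ioc (0 : ℝ) γ, ∀ y ∈ Ioc (0 : ℝ) γ,
      |kernelA F ℰ ρ bV (Function.update h m x) k μ ν z - kernelA F ℰ ρ bV (Function.update h m y) k μ ν z| ≤
        (2 * C₅ / (1 - θ) + 2 * E₀) * θ ^ (k - m) * Real.exp (-(κ * l1 z)) := by
    intro h hh k μ ν z m hm x hx y hy
    have hagree : ∀ n, m + 1 ≤ n → Function.update h m x n = Function.update h m y n := fun n hn => by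
      have hnm : n ≠ m := by omega
      rw [Function.update_of_ne hnm, Function.update_of_ne hnm]
    have h1 := hosc _ (update_mem_window hh m hx) _ (update_mem_window hh m hy) PUnit.unit (k, μ, ν, z) (m + 1) (by exact hm) hagree
    rw [EA_apply, EA_apply] at h1
    simpa [show k + 1 - (m + 1) = k - m by omega] using h1
  refine ⟨ne9_EA_of_windowed F ℰ ρ bV hlim fun g hg g' hg' k μ ν z => ?_, ?_⟩
  · exact eventually_windowedNE9Bound_of_kernelFlat F ℰ ρ bV hγ hr hθ0 hθ1.le hC₀ hCB hs0 hs1 hflat hlim hA hg hg' k μ ν z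
  · refine fadingMemory_geometric ?_ hτ0.le
    have h1 : 0 ≤ (2 * (2 * C₅ / (1 - θ) + 2 * E₀)) ^ (1 - s) := Real.rpow_nonneg (by positivity) _
    have h2 : 0 ≤ (2 * B) ^ s := Real.rpow_nonneg (by linarith [hC₀.le.trans hCB]) _
    have h3 : 0 < min (r / 2) (γ / 2) := lt_min (by linarith) (by linarith)
    positivity

/-- ★★ **THE SAME WITH THE LEVEL-0 BASE IN PLACE OF THE UNIFORM DECAY** (dag-n18-w4's `decayBound_EA_of_kernelStepRate_of_base` BY NAME): N18's step rate + the level-0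
(5.10) class `Decay510 (Π_1(g; ·)) E₀ κ` ⟹ `DecayBound (EA …) (Window γ) (E₀ + C₅θ∕(1−θ)) κ`, hence NE9 ∧ fading memory at every rate above `θ`. [folklore] -/
theorem ne9_and_fadingMemory_EA_of_kernelStepRate_base_windowedHolo {γ κ θ C₅ E₀ B r s : ℝ}
    (hC₅ : 0 ≤ C₅) (hθ0 : 0 < θ) (hθ1 : θ < 1) (hE₀ : 0 < E₀) (hγ : 0 < γ) (hr : 0 < r) (hs0 : 0 < s) (hs1 : s < 1)
    (h5 : KernelStepRate F ℰ ρ bV γ κ θ C₅)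
    (h0 : ∀ g ∈ Window γ, ∀ (μ ν : Fin 4), B12Sec2to5.Decay510 (kernelA F ℰ ρ bV g 0 μ ν) E₀ κ)
    (hCB : 2 * C₅ / (1 - θ) + 2 * (E₀ + C₅ * (θ / (1 - θ))) ≤ B)
    (hlim : ∀ g ∈ Window γ, ∀ k : ℕ, PolLimitExists F (k + 1) (fun K => ℰ k (histPrefix g k) K) ρ bV)
    (hA : ∀ h ∈ Window γ, ∀ (k : ℕ) (μ ν : Fin 4) (z : Fin 4 → ℤ) (m : ℕ), m < k + 1 → ∀ᶠ K in atTop,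
      ∃ (Fc : ℂ → ℂ) (D : Set ℂ), DifferentiableOn ℂ Fc D ∧ (∀ w ∈ D, ‖Fc w‖ ≤ B * Real.exp (-(κ * l1 z))) ∧
        (∀ t ∈ Ioc (0 : ℝ) γ, closedBall (t : ℂ) r ⊆ D) ∧
        (∀ t ∈ Ioc (0 : ℝ) γ, Fc t = (polWindow F K (k + 1) (ℰ k (histPrefix (Function.update h m t) k) K) ρ bV μ ν z : ℂ))) :
    NE9 (EA F ℰ ρ bV) (Window γ) κ
        (fun k i => 32 / (s ^ 2 * min (r / 2) (γ / 2)) * ((2 * (2 * C₅ / (1 - θ) + 2 * (E₀ + C₅ * (θ / (1 - θ))))) ^ (1 - s) * (2 * B) ^ s) /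
          θ ^ (1 - s) * (θ ^ (1 - s)) ^ (k - i)) ∧
      FadingMemory (32 / (s ^ 2 * min (r / 2) (γ / 2)) * ((2 * (2 * C₅ / (1 - θ) + 2 * (E₀ + C₅ * (θ / (1 - θ))))) ^ (1 - s) * (2 * B) ^ s) /
          θ ^ (1 - s)) (θ ^ (1 - s))
        (fun k i => 32 / (s ^ 2 * min (r / 2) (γ / 2)) * ((2 * (2 * C₅ / (1 - θ) + 2 * (E₀ + C₅ * (θ / (1 - θ))))) ^ (1 - s) * (2 * B) ^ s) /
          θ ^ (1 - s) * (θ ^ (1 - s)) ^ (k - i)) := by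
  have h1θ : 0 < 1 - θ := by linarith
  have hE₀' : 0 < E₀ + C₅ * (θ / (1 - θ)) := by positivity
  exact ne9_and_fadingMemory_EA_of_kernelStepRate_windowedHolo F ℰ ρ bV hC₅ hθ0 hθ1 hE₀' hγ hr hs0 hs1 h5
    (decayBound_EA_of_kernelStepRate_of_base F ρ bV hθ0.le hθ1 hC₅ h5 h0) hCB hlim hA

end Generic

/-! ## §2 AT THE RECORD: K3⁷ v5 §2b's `h9` with the record's GEOMETRIC moduli at every rate above `ℓ.θ₅`, and the N22 pin face -/

section Record

variable (F : T4Family) (N : ℕ) [NeZero N]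

/-- ★★★ **K3⁷ v5 §2b's `h9` WITH THE RECORD's MODULI ON THE ANALYTIC ROAD**: at a Stage-13 tuple `θ` (`0 < θ.γ`) and a letter block `ℓ` with its signs,
`KernelStepRateOfRecord₁₃ F N θ κ ℓ.θ₅ C₅` + `DecayBound ((objectsOfRecord₁₃ F N θ ℓ).EA 0) (Window θ.γ) E₀ κ` (`E₀ > 0`) + `PolLimitsExistOfRecord₁₃ F N θ` + the WINDOWED
coupling-holomorphy datum of the merged term family of record (uniform `B ≥ 2C₅∕(1−ℓ.θ₅) + 2E₀`, `r > 0`; DISPLAYED) + the LETTER ROWS `0 < s < 1`, `ℓ.θ₅^{1−s} ≤ ℓ.ω`,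
`ℓ.κ ≤ κ`, `C₉(s) ≤ ℓ.C₉` ⟹ **`NE9 ((objectsOfRecord₁₃ F N θ ℓ).EA 0) (Window θ.γ) ℓ.κ ℓ.moduli`** (§1 + `ne9_mono`); rows satisfiable with `ℓ.Signs` for EVERY
`ℓ.ω ∈ ]ℓ.θ₅, 1[` — versus J38's `ℓ.θ₅ ≤ ℓ.ω²`.  LOCATED; N22 NOT discharged. [folklore] -/
theorem ne9_EA_objectsOfRecord₁₃_of_kernelStepRate_windowedHolo (θ : Stage13Params F N) (ℓ : U3Letters₁₁) (hs : ℓ.Signs) (hγ : 0 < θ.γ)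
    {κ C₅ E₀ B r s : ℝ} (hC₅ : 0 ≤ C₅) (hE₀ : 0 < E₀) (hr : 0 < r) (hs0 : 0 < s) (hs1 : s < 1)
    (h5 : KernelStepRateOfRecord₁₃ F N θ κ ℓ.θ₅ C₅)
    (hdec : DecayBound ((objectsOfRecord₁₃ F N θ ℓ).EA 0) (Window θ.γ) E₀ κ)
    (hCB : 2 * C₅ / (1 - ℓ.θ₅) + 2 * E₀ ≤ B)
    (hlim : PolLimitsExistOfRecord₁₃ F N θ)
    (hA : letI := θ.instVβ₁; letI := θ.instVβ₂; letI := θ.instιβ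
      ∀ h ∈ Window θ.γ, ∀ (k : ℕ) (μ ν : Fin 4) (z : Fin 4 → ℤ) (m : ℕ), m < k + 1 → ∀ᶠ K in atTop,
        ∃ (Fc : ℂ → ℂ) (D : Set ℂ), DifferentiableOn ℂ Fc D ∧ (∀ w ∈ D, ‖Fc w‖ ≤ B * Real.exp (-(κ * l1 z))) ∧
          (∀ t ∈ Ioc (0 : ℝ) θ.γ, closedBall (t : ℂ) r ⊆ D) ∧
          (∀ t ∈ Ioc (0 : ℝ) θ.γ, Fc t = (polWindow F K (k + 1)
            (mergedTermFamilyMatT F N (TβOfRecord₁₃ F N) (chiβOfRecord₁₃ F N θ) θ.εbg k (histPrefix (Function.update h m t) k) K) θ.ρ8 θ.bV μ ν z : ℂ)))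
    (hτω : ℓ.θ₅ ^ (1 - s) ≤ ℓ.ω) (hκ : ℓ.κ ≤ κ)
    (hC₉ : 32 / (s ^ 2 * min (r / 2) (θ.γ / 2)) * ((2 * (2 * C₅ / (1 - ℓ.θ₅) + 2 * E₀)) ^ (1 - s) * (2 * B) ^ s) / ℓ.θ₅ ^ (1 - s) ≤ ℓ.C₉) :
    NE9 ((objectsOfRecord₁₃ F N θ ℓ).EA 0) (Window θ.γ) ℓ.κ ℓ.moduli := by
  letI := θ.instVβ₁; letI := θ.instVβ₂; letI := θ.instιβ
  have h := ne9_and_fadingMemory_EA_of_kernelStepRate_windowedHolo F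
    (mergedTermFamilyMatT F N (TβOfRecord₁₃ F N) (chiβOfRecord₁₃ F N θ) θ.εbg) θ.ρ8 θ.bV hC₅ hs.θ₅_pos hs.θ₅_lt_one hE₀ hγ hr hs0 hs1 h5 hdec hCB
    hlim hA
  have hτ0 : 0 ≤ ℓ.θ₅ ^ (1 - s) := Real.rpow_nonneg hs.θ₅_pos.le _
  have hC90 : 0 ≤ 32 / (s ^ 2 * min (r / 2) (θ.γ / 2)) * ((2 * (2 * C₅ / (1 - ℓ.θ₅) + 2 * E₀)) ^ (1 - s) * (2 * B) ^ s) / ℓ.θ₅ ^ (1 - s) :=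
    (h.2 0 0 le_rfl).1.trans_eq (by simp)
  refine ne9_mono h.1 hκ (fun k i => ?_) (hs.moduli_nonneg)
  rw [U3Letters₁₁.moduli_apply]
  exact mul_le_mul hC₉ (pow_le_pow_left₀ hτ0 hτω _) (pow_nonneg hτ0 _) hs.C₉_nonneg

open Classical in
/-- ★★★ **THE N22 PIN FACE ON THE ANALYTIC ROAD**: under K3⁷ v5's node-U3 pin (`hpin`) the inputs above give `N22At (rateCarriersOfRecord₁₃CoPH 𝔯 F θ hP g₀ os k).u3` for
EVERY run length `k` (dag-n22-w3's junction BY NAME): «N18's kernel step rate + uniform decay + (1.21) + windowed coupling holomorphy on uniform margins + rows (`ℓ.ω`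
ANYWHERE in `]ℓ.θ₅, 1[`) ⇒ v5 §2b `h9` ∕ `N22At` at the pinned bundle».  LOCATED; N22 NOT discharged. [folklore] -/
theorem n22At_rateCarriers_of_kernels_pin_of_kernelStepRate_windowedHolo (𝔯 : RateReading₁₃CoPH N) (θ : Stage13HParams F N) (hP : θ.Provisos₁₃CoPH F N)
    (g₀ : ℕ → ℝ) (os : List (ULoop F)) (ℓ : U3Letters₁₁) (hs : ℓ.Signs) (hγ : 0 < θ.γ)
    (hpin : (𝔯.lit F θ hP g₀ os).u3 = objectsOfRecord₁₃ F N θ.toStage13Params ℓ)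
    {κ C₅ E₀ B r s : ℝ} (hC₅ : 0 ≤ C₅) (hE₀ : 0 < E₀) (hr : 0 < r) (hs0 : 0 < s) (hs1 : s < 1)
    (h5 : KernelStepRateOfRecord₁₃ F N θ.toStage13Params κ ℓ.θ₅ C₅)
    (hdec : DecayBound ((objectsOfRecord₁₃ F N θ.toStage13Params ℓ).EA 0) (Window θ.γ) E₀ κ)
    (hCB : 2 * C₅ / (1 - ℓ.θ₅) + 2 * E₀ ≤ B)
    (hlim : PolLimitsExistOfRecord₁₃ F N θ.toStage13Params)
    (hA : letI := θ.instVβ₁; letI := θ.instVβ₂; letI := θ.instιβ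
      ∀ h ∈ Window θ.γ, ∀ (k : ℕ) (μ ν : Fin 4) (z : Fin 4 → ℤ) (m : ℕ), m < k + 1 → ∀ᶠ K in atTop,
        ∃ (Fc : ℂ → ℂ) (D : Set ℂ), DifferentiableOn ℂ Fc D ∧ (∀ w ∈ D, ‖Fc w‖ ≤ B * Real.exp (-(κ * l1 z))) ∧
          (∀ t ∈ Ioc (0 : ℝ) θ.γ, closedBall (t : ℂ) r ⊆ D) ∧
          (∀ t ∈ Ioc (0 : ℝ) θ.γ, Fc t = (polWindow F K (k + 1)
            (mergedTermFamilyMatT F N (TβOfRecord₁₃ F N) (chiβOfRecord₁₃ F N θ.toStage13Params) θ.εbg k (histPrefix (Function.update h m t) k) K)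
              θ.ρ8 θ.bV μ ν z : ℂ)))
    (hτω : ℓ.θ₅ ^ (1 - s) ≤ ℓ.ω) (hκ : ℓ.κ ≤ κ)
    (hC₉ : 32 / (s ^ 2 * min (r / 2) (θ.γ / 2)) * ((2 * (2 * C₅ / (1 - ℓ.θ₅) + 2 * E₀)) ^ (1 - s) * (2 * B) ^ s) / ℓ.θ₅ ^ (1 - s) ≤ ℓ.C₉)
    (k : ℕ) :
    N22At (rateCarriersOfRecord₁₃CoPH 𝔯 F θ hP g₀ os k).u3 :=
  n22At_rateCarriers_of_kernels_pin_of_ne9 𝔯 θ hP g₀ os ℓ hs hpin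
    (ne9_EA_objectsOfRecord₁₃_of_kernelStepRate_windowedHolo F N θ.toStage13Params ℓ hs hγ hC₅ hE₀ hr hs0 hs1 h5 hdec hCB hlim hA hτω hκ hC₉) k

end Record

/-! ## §3 RIDER (A5): the displayed inputs of §1 are JOINTLY SATISFIABLE — at the zero probe chart every windowed kernel vanishes, and §1 fires -/

section Rider

variable {𝔄 : Type*} [NormedRing 𝔄] [NormedAlgebra ℝ 𝔄]
variable {V : Type*} [NormedAddCommGroup V] [NormedSpace ℝ V] {ι : Type*} [Fintype ι]
variable (F : T4Family) (ℰ : TermFamily1 F 𝔄) (bV : Module.Basis ι ℝ V)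

/-- At the zero chart `ρ = 0` the limiting kernels vanish (`polLimit_zeroChart`, dag-n23-b). [folklore] -/
theorem kernelA_zeroChart (g : ℕ → ℝ) (k : ℕ) (μ ν : Fin 4) (z : Fin 4 → ℤ) :
    kernelA F ℰ (0 : V →L[ℝ] 𝔄) bV g k μ ν z = 0 := by
  rw [kernelA_eq, polLimit_zeroChart]

/-- **A5 RIDER — THE HYPOTHESES OF §1 ARE JOINTLY INHABITED AND §1 FIRES** (DEGENERATE witness: the zero probe chart `ρ = 0`, every windowed and limiting kernel `0`,
`Fc ≡ 0`; for EVERY `ℰ`) — §1 is not bought from contradictory binders; nothing about print's `su(N) ↪ M_N(ℂ)` chart. [folklore] -/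
theorem ne9_and_fadingMemory_EA_zeroChart {γ θ C₅ E₀ B r s : ℝ} (hC₅ : 0 ≤ C₅) (hθ0 : 0 < θ) (hθ1 : θ < 1) (hE₀ : 0 < E₀)
    (hγ : 0 < γ) (hr : 0 < r) (hs0 : 0 < s) (hs1 : s < 1) (hCB : 2 * C₅ / (1 - θ) + 2 * E₀ ≤ B) (κ : ℝ) :
    ∃ C₉ : ℝ, NE9 (EA F ℰ (0 : V →L[ℝ] 𝔄) bV) (Window γ) κ (fun k i => C₉ * (θ ^ (1 - s)) ^ (k - i)) ∧
      FadingMemory C₉ (θ ^ (1 - s)) (fun k i => C₉ * (θ ^ (1 - s)) ^ (k - i)) := by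
  have hB : 0 ≤ B := by
    have h1θ : 0 < 1 - θ := by linarith
    have : 0 ≤ 2 * C₅ / (1 - θ) + 2 * E₀ := by positivity
    linarith
  have h5 : KernelStepRate F ℰ (0 : V →L[ℝ] 𝔄) bV γ κ θ C₅ := by
    intro b _ _ g _ k μ ν z
    rw [kernelA_zeroChart, kernelA_zeroChart, sub_self, abs_zero]
    positivity
  have hdec : DecayBound (EA F ℰ (0 : V →L[ℝ] 𝔄) bV) (Window γ) E₀ κ := by
    intro g _ U X
    rw [EA_apply, kernelA_zeroChart, abs_zero]
    positivity
  have hlim : ∀ g ∈ Window γ, ∀ k : ℕ, PolLimitExists F (k + 1) (fun K => ℰ k (histPrefix g k) K) (0 : V →L[ℝ] 𝔄) bV :=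
    fun g _ k => polLimitExists_zeroChart F bV (k + 1) _
  have hA : ∀ h ∈ Window γ, ∀ (k : ℕ) (μ ν : Fin 4) (z : Fin 4 → ℤ) (m : ℕ), m < k + 1 → ∀ᶠ K in atTop,
      ∃ (Fc : ℂ → ℂ) (D : Set ℂ), DifferentiableOn ℂ Fc D ∧ (∀ w ∈ D, ‖Fc w‖ ≤ B * Real.exp (-(κ * l1 z))) ∧
        (∀ t ∈ Ioc (0 : ℝ) γ, closedBall (t : ℂ) r ⊆ D) ∧
        (∀ t ∈ Ioc (0 : ℝ) γ, Fc t = (polWindow F K (k + 1) (ℰ k (histPrefix (Function.update h m t) k) K) (0 : V →L[ℝ] 𝔄) bV μ ν z : ℂ)) := by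
    intro h _ k μ ν z m _
    refine Eventually.of_forall fun K => ⟨fun _ => 0, Set.univ, differentiableOn_const 0, fun w _ => ?_, fun t _ => Set.subset_univ _, fun t _ => ?_⟩
    · rw [norm_zero]; positivity
    · rw [polWindow_zeroChart]; simp
  exact ⟨_, ne9_and_fadingMemory_EA_of_kernelStepRate_windowedHolo F ℰ 0 bV hC₅ hθ0 hθ1 hE₀ hγ hr hs0 hs1 h5 hdec hCB hlim hA⟩

end Rider
end YMDAG.N22.KernelFadingTwoConstants

end
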